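import Summits.CriticalPhenomena.PercolationContinuityZ3.Theorems.PercNearOneGluingNoHeavyLowerTailPathExchange
import HarnessLib

/-!
# `NoHeavyLowerTail` (stmt-CriticalPhenomena-4575) — TRACE EXCHANGE for three relays: o's pocket events are
# associated with the sink's cluster decomposition (a five-terminal exchange from BHK's two-set theorem)

Support file (prover prim-gen-kcluster gen 2; `--supports stmt-CriticalPhenomena-4575`).  No definitions, no sorries.

Setting: observer `o`, sink `b`, relays `a₁, a₂, a₃`; the TRACE of the sink is `T_b := {i : aᵢ ↔ b}` and the worst-first pocket events are
`E₁ = {o ↔ a₁}`, `E₂ = {o ↔ a₂, o ↮ a₁}`.  The seat's census (KCLUSTER-gen2.md §8) found that all robust quadratic relations between the cells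
`c(S, E) = μ(T_b = S, E)` are exchanges of the shape "traces containing `a_j` favour `E_j`".  This file PROVES the representative five-terminal one,

  `c({a₁}, E₂) · c({a₂,a₃}, E₁) ≤ c({a₁}, E₁) · c({a₂,a₃}, E₂)`                                   (`traceExchange`),

i.e. `μ(a₁↔b, a₂↮b, a₃↮b, o↔a₂, o↮a₁) · μ(a₂↔b, a₃↔b, a₁↮b, o↔a₁) ≤ μ(a₁↔b, a₂↮b, a₃↮b, o↔a₁) · μ(a₂↔b, a₃↔b, a₁↮b, o↔a₂, o↮a₁)`,
as the instance `S = {a₁}`, `T = {a₂, a₃}` of `Literature.…setClusterEventExchange` (BHK 2006 Thm 1.5/2.1 with vertex sets) with the increasing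
cluster predicates `A₁ = {b touched by C_S}`, `A₂ = {o touched by C_S}`, `B₁ = {o reachable from a₂ inside C_T}`,
`B₂ = {b reachable from a₂ and from a₃ inside C_T}` (`traceExchange_set`), read on events via `PathExchange.reachIn_biUnion_iff`.
For two relays the same recipe gives the tripod exchange (`tripodExchange`) and the path exchange (`pathExchange`).
-/

noncomputable section

namespace Summit.CriticalPhenomena.PercolationContinuityZ3.Theorems

open MeasureTheory Set Literature.Probability.LatticeModels Literature.Probability.Percolation
open scoped Classical

namespace TraceExchange

variable {V : Type*}

/-- **Trace exchange, set form.**  With `S = {a₁}`, `T = {a₂, a₃}`, `D = {S ↮ T}`: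
`μ(D ∩ {a₁↔b} ∩ {a₂↔o}) · μ(D ∩ {a₁↔o} ∩ ({a₂↔b} ∩ {a₃↔b})) ≤ μ(D ∩ {a₁↔b} ∩ {a₁↔o}) · μ(D ∩ {a₂↔o} ∩ ({a₂↔b} ∩ {a₃↔b}))`.
[cite: VandenbergHaggstromKahn2005, Thm. 2.1 (p. 9) at q = 1 with Remark 1 (p. 5) — corollary via `setClusterEventExchange`, derived in this file] -/
theorem traceExchange_set [Fintype V] (w : Sym2 V → unitInterval) (o b a₁ a₂ a₃ : V) :
    (prodBernoulli w).real (({ω : BondConfig V | ∀ s ∈ ({a₁} : Set V), ∀ t ∈ ({a₂, a₃} : Set V),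
        ¬ (openGraph ω).Reachable s t}) ∩ (openConn a₁ b ∩ openConn a₂ o)) *
      (prodBernoulli w).real (({ω : BondConfig V | ∀ s ∈ ({a₁} : Set V), ∀ t ∈ ({a₂, a₃} : Set V),
        ¬ (openGraph ω).Reachable s t}) ∩ (openConn a₁ o ∩ (openConn a₂ b ∩ openConn a₃ b))) ≤
    (prodBernoulli w).real (({ω : BondConfig V | ∀ s ∈ ({a₁} : Set V), ∀ t ∈ ({a₂, a₃} : Set V),
        ¬ (openGraph ω).Reachable s t}) ∩ (openConn a₁ b ∩ openConn a₁ o)) *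
      (prodBernoulli w).real (({ω : BondConfig V | ∀ s ∈ ({a₁} : Set V), ∀ t ∈ ({a₂, a₃} : Set V),
        ¬ (openGraph ω).Reachable s t}) ∩ (openConn a₂ o ∩ (openConn a₂ b ∩ openConn a₃ b))) := by
  set S : Set V := {a₁} with hS
  set T : Set V := {a₂, a₃} with hT
  have h2T : a₂ ∈ T := by rw [hT]; exact mem_insert a₂ {a₃}
  have h3T : a₃ ∈ T := by rw [hT]; exact mem_insert_of_mem a₂ rfl
  have key := setClusterEventExchange w S T
    (fun C => b ∈ S ∨ ∃ e ∈ C, b ∈ e) (fun C => o ∈ S ∨ ∃ e ∈ C, o ∈ e)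
    (fun C => (SimpleGraph.fromEdgeSet C).Reachable a₂ o)
    (fun C => (SimpleGraph.fromEdgeSet C).Reachable a₂ b ∧ (SimpleGraph.fromEdgeSet C).Reachable a₃ b)
    (fun C C' h => Or.imp_right fun ⟨e, he, hbe⟩ => ⟨e, h he, hbe⟩)
    (fun C C' h => Or.imp_right fun ⟨e, he, hoe⟩ => ⟨e, h he, hoe⟩)
    (fun C C' h hr => PathExchange.reachIn_mono a₂ o h hr)
    (fun C C' h hr => ⟨PathExchange.reachIn_mono a₂ b h hr.1, PathExchange.reachIn_mono a₃ b h hr.2⟩)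
  have eS1 : {ω : BondConfig V | b ∈ S ∨ ∃ e ∈ ⋃ s ∈ S, openEdgeCluster ω s, b ∈ e} = openConn a₁ b := by
    rw [TwoSetConditionalAssociation.setOf_mem_or_exists_mem_biUnion_openEdgeCluster S b, hS]
    simp only [mem_singleton_iff, iUnion_iUnion_eq_left]
  have eS2 : {ω : BondConfig V | o ∈ S ∨ ∃ e ∈ ⋃ s ∈ S, openEdgeCluster ω s, o ∈ e} = openConn a₁ o := by
    rw [TwoSetConditionalAssociation.setOf_mem_or_exists_mem_biUnion_openEdgeCluster S o, hS]
    simp only [mem_singleton_iff, iUnion_iUnion_eq_left]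
  have eT1 : {ω : BondConfig V | (SimpleGraph.fromEdgeSet (⋃ t ∈ T, openEdgeCluster ω t)).Reachable a₂ o} =
      openConn a₂ o := by
    ext ω; exact PathExchange.reachIn_biUnion_iff ω T a₂ o h2T
  have eT2 : {ω : BondConfig V | (SimpleGraph.fromEdgeSet (⋃ t ∈ T, openEdgeCluster ω t)).Reachable a₂ b ∧
      (SimpleGraph.fromEdgeSet (⋃ t ∈ T, openEdgeCluster ω t)).Reachable a₃ b} = openConn a₂ b ∩ openConn a₃ b := by
    ext ω
    simp only [mem_setOf_eq, mem_inter_iff]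
    rw [PathExchange.reachIn_biUnion_iff ω T a₂ b h2T, PathExchange.reachIn_biUnion_iff ω T a₃ b h3T]
    rfl
  simp only [eS1, eS2, eT1, eT2] at key
  exact key

end TraceExchange

open TraceExchange

variable {V : Type*}

/-- **Trace exchange (five-terminal event form, PROVED).**  For observer `o`, sink `b` and relays `a₁, a₂, a₃`:
`μ(a₁↔b, a₂↮b, a₃↮b, o↔a₂, o↮a₁) · μ(a₂↔b, a₃↔b, a₁↮b, o↔a₁) ≤ μ(a₁↔b, a₂↮b, a₃↮b, o↔a₁) · μ(a₂↔b, a₃↔b, a₁↮b, o↔a₂, o↮a₁)`,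
i.e. `c({a₁},E₂)·c({a₂,a₃},E₁) ≤ c({a₁},E₁)·c({a₂,a₃},E₂)` for the sink-trace cells of the worst-first pocket events. [this file] -/
theorem traceExchange [Fintype V] (w : Sym2 V → unitInterval) (o b a₁ a₂ a₃ : V) :
    (prodBernoulli w).real (openConn a₁ b ∩ (openConn a₂ b)ᶜ ∩ (openConn a₃ b)ᶜ ∩ openConn o a₂ ∩ (openConn o a₁)ᶜ) *
        (prodBernoulli w).real (openConn a₂ b ∩ openConn a₃ b ∩ (openConn a₁ b)ᶜ ∩ openConn o a₁) ≤
      (prodBernoulli w).real (openConn a₁ b ∩ (openConn a₂ b)ᶜ ∩ (openConn a₃ b)ᶜ ∩ openConn o a₁) *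
        (prodBernoulli w).real (openConn a₂ b ∩ openConn a₃ b ∩ (openConn a₁ b)ᶜ ∩ openConn o a₂ ∩ (openConn o a₁)ᶜ) := by
  have key := traceExchange_set w o b a₁ a₂ a₃
  set D : Set (BondConfig V) := {ω : BondConfig V | ∀ s ∈ ({a₁} : Set V), ∀ t ∈ ({a₂, a₃} : Set V),
        ¬ (openGraph ω).Reachable s t} with hD'
  have hD : ∀ ω : BondConfig V, ω ∈ D ↔ (¬ (openGraph ω).Reachable a₁ a₂ ∧ ¬ (openGraph ω).Reachable a₁ a₃) := by
    intro ω
    simp only [hD', mem_setOf_eq, mem_insert_iff, mem_singleton_iff, forall_eq_or_imp, forall_eq]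
  have e1 : D ∩ (openConn a₁ b ∩ openConn a₂ o) =
      (openConn a₁ b ∩ (openConn a₂ b)ᶜ ∩ (openConn a₃ b)ᶜ ∩ openConn o a₂ ∩ (openConn o a₁)ᶜ : Set (BondConfig V)) := by
    ext ω
    simp only [mem_inter_iff, mem_compl_iff, hD ω, openConn, mem_setOf_eq]
    constructor
    · rintro ⟨⟨h12, h13⟩, h1b, h2o⟩
      exact ⟨⟨⟨⟨h1b, fun h2b => h12 (h1b.trans (PathExchange.rs h2b))⟩, fun h3b => h13 (h1b.trans (PathExchange.rs h3b))⟩, PathExchange.rs h2o⟩,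
        fun ho1 => h12 ((PathExchange.rs ho1).trans (PathExchange.rs h2o))⟩
    · rintro ⟨⟨⟨⟨h1b, h2b⟩, h3b⟩, ho2⟩, ho1⟩
      refine ⟨⟨fun h12 => ho1 (ho2.trans (PathExchange.rs h12)), fun h13 => h3b ((PathExchange.rs h13).trans h1b)⟩, h1b, PathExchange.rs ho2⟩
  have e2 : D ∩ (openConn a₁ o ∩ (openConn a₂ b ∩ openConn a₃ b)) =
      (openConn a₂ b ∩ openConn a₃ b ∩ (openConn a₁ b)ᶜ ∩ openConn o a₁ : Set (BondConfig V)) := by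
    ext ω
    simp only [mem_inter_iff, mem_compl_iff, hD ω, openConn, mem_setOf_eq]
    constructor
    · rintro ⟨⟨h12, _⟩, h1o, h2b, h3b⟩
      exact ⟨⟨⟨h2b, h3b⟩, fun h1b => h12 (h1b.trans (PathExchange.rs h2b))⟩, PathExchange.rs h1o⟩
    · rintro ⟨⟨⟨h2b, h3b⟩, h1b⟩, ho1⟩
      exact ⟨⟨fun h12 => h1b (h12.trans h2b), fun h13 => h1b (h13.trans h3b)⟩, PathExchange.rs ho1, h2b, h3b⟩
  have e3 : D ∩ (openConn a₁ b ∩ openConn a₁ o) =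
      (openConn a₁ b ∩ (openConn a₂ b)ᶜ ∩ (openConn a₃ b)ᶜ ∩ openConn o a₁ : Set (BondConfig V)) := by
    ext ω
    simp only [mem_inter_iff, mem_compl_iff, hD ω, openConn, mem_setOf_eq]
    constructor
    · rintro ⟨⟨h12, h13⟩, h1b, h1o⟩
      exact ⟨⟨⟨h1b, fun h2b => h12 (h1b.trans (PathExchange.rs h2b))⟩, fun h3b => h13 (h1b.trans (PathExchange.rs h3b))⟩, PathExchange.rs h1o⟩
    · rintro ⟨⟨⟨h1b, h2b⟩, h3b⟩, ho1⟩
      exact ⟨⟨fun h12 => h2b ((PathExchange.rs h12).trans h1b), fun h13 => h3b ((PathExchange.rs h13).trans h1b)⟩, h1b, PathExchange.rs ho1⟩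
  have e4 : D ∩ (openConn a₂ o ∩ (openConn a₂ b ∩ openConn a₃ b)) =
      (openConn a₂ b ∩ openConn a₃ b ∩ (openConn a₁ b)ᶜ ∩ openConn o a₂ ∩ (openConn o a₁)ᶜ : Set (BondConfig V)) := by
    ext ω
    simp only [mem_inter_iff, mem_compl_iff, hD ω, openConn, mem_setOf_eq]
    constructor
    · rintro ⟨⟨h12, _⟩, h2o, h2b, h3b⟩
      exact ⟨⟨⟨⟨h2b, h3b⟩, fun h1b => h12 (h1b.trans (PathExchange.rs h2b))⟩, PathExchange.rs h2o⟩, fun ho1 => h12 ((PathExchange.rs ho1).trans (PathExchange.rs h2o))⟩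
    · rintro ⟨⟨⟨⟨h2b, h3b⟩, h1b⟩, ho2⟩, ho1⟩
      exact ⟨⟨fun h12 => h1b (h12.trans h2b), fun h13 => h1b (h13.trans h3b)⟩, PathExchange.rs ho2, h2b, h3b⟩
  rw [e1, e2, e3, e4] at key
  exact key

end Summit.CriticalPhenomena.PercolationContinuityZ3.Theorems

end
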